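import Literature.Topology.FourManifolds.CappellShanesonClassNumberTwo
import HarnessLib

/-!
# Certificates for identities of two-generated ideals

A small algebraic toolkit used by the class-group computations for the Cappell–Shaneson trace fields
(`CappellShanesonClassGroup*.lean`, serving Kim–Yamada 2023, Theorem B): an equality
`(a, b)(c, d) = (e, f)` of ideals in a commutative ring is certified by explicit cofactors — each
product `ac, ad, bc, bd` is a combination of `e, f`, and `e`, `f` are combinations of the products.
(The companion certificate for `(a, b)(c, d) = (x)` is `span_pair_mul_span_pair_eq_span_singleton` in
`CappellShanesonClassNumberTwo.lean`.) Used for the powers `𝔭ᵏ = (pᵏ, θ - c)` of a degree-one prime. [folklore]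

## References

* [Marcus2018] D. A. Marcus, *Number Fields*, 2nd ed., Ch. 3 (ideal arithmetic in `𝓞 K`).
-/

open Ideal

namespace Literature.Topology.FourManifolds

/-! ### Certificate for an equality `(a, b)(c, d) = (e, f)` of ideals -/

section Certificate

/-- **Certificate for `(a, b)(c, d) = (e, f)`**: it suffices that each of the four products
`ac, ad, bc, bd` is a combination of `e, f` and that `e`, `f` are combinations of the products. [folklore] -/
theorem span_pair_mul_span_pair_eq_span_pair {R : Type*} [CommRing R]
    {a b c d e f α₁ β₁ α₂ β₂ α₃ β₃ α₄ β₄ u₁ u₂ u₃ u₄ v₁ v₂ v₃ v₄ : R}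
    (h1 : a * c = α₁ * e + β₁ * f) (h2 : a * d = α₂ * e + β₂ * f)
    (h3 : b * c = α₃ * e + β₃ * f) (h4 : b * d = α₄ * e + β₄ * f)
    (he : e = u₁ * (a * c) + u₂ * (a * d) + u₃ * (b * c) + u₄ * (b * d))
    (hf : f = v₁ * (a * c) + v₂ * (a * d) + v₃ * (b * c) + v₄ * (b * d)) :
    span {a, b} * span {c, d} = span ({e, f} : Set R) := by
  have hmem : ∀ {x α β : R}, x = α * e + β * f → x ∈ span ({e, f} : Set R) := by
    intro x α β hx
    rw [hx, Ideal.mem_span_pair]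
    exact ⟨α, β, rfl⟩
  rw [Ideal.span_pair_mul_span_pair]
  apply le_antisymm
  · rw [Ideal.span_le]
    rintro x hx
    simp only [Set.mem_insert_iff, Set.mem_singleton_iff] at hx
    rcases hx with rfl | rfl | rfl | rfl
    · exact hmem h1
    · exact hmem h2
    · exact hmem h3
    · exact hmem h4
  · have hprod : ∀ {y w₁ w₂ w₃ w₄ : R},
        y = w₁ * (a * c) + w₂ * (a * d) + w₃ * (b * c) + w₄ * (b * d) →
          y ∈ span ({a * c, a * d, b * c, b * d} : Set R) := by
      intro y w₁ w₂ w₃ w₄ hy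
      rw [hy]
      refine Ideal.add_mem _ (Ideal.add_mem _ (Ideal.add_mem _ ?_ ?_) ?_) ?_ <;>
        exact Ideal.mul_mem_left _ _ (Ideal.subset_span (by simp))
    rw [Ideal.span_le]
    rintro y hy
    simp only [Set.mem_insert_iff, Set.mem_singleton_iff] at hy
    rcases hy with rfl | rfl
    · exact hprod he
    · exact hprod hf

end Certificate

end Literature.Topology.FourManifolds
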